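import Summits.KontsevichZagierPeriods.KontsevichZagierPeriods.Theorems.SoloBlindQuarticS1Prep
import Summits.KontsevichZagierPeriods.KontsevichZagierPeriods.Theorems.SoloBlindQuarticSecond
import HarnessLib

/-!
# Quartic family, second kind, pattern `(½-x, 4x, 3/2-3x)` — the relation in `Q` and the merge

Sol Binde (solo-blind track), 2026-08-20.

With the pulled-back integrands `G_A, G_B, G_C` and the primitive `P` of `SoloBlindQuarticS1Prep`
(`P' = (1-6x)G_B + (1+2x)G_A - ((1-4x)/2)64^{x}G_C`, `P(0) = P(1) = 0`), the KZ chain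
three substitutions → one Newton–Leibniz move → two additivity splits gives, for every rational
`0 < x < 1/2`, the relation

  `(1-6x) • β(½-x, 4x) + (1+2x) • β(4x, 3/2-3x) = ((1-4x)/2)·64^{x} • β(3/2-3x, x)`  (in `Q`),

all three Betas of the second kind (parameter sums `½+3x`, `3/2+x`, `3/2-2x`).  For
`1/6 < x < 1/4` the second-kind orbit relation then merges the orbit of `{½-x, 4x, 3/2-3x}`
with that of `{3/2-3x, x, ½+2x}`:  `β(½-x, 4x) ≐ β(3/2-3x, x)`.
Instances: levels `14` (`{4,12,12} ~ {3,12,13}`), `16` (`{5,12,15} ~ {3,14,15}`), `10`, `24` —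
the first two were the last level-`14`/`16` second-kind classes predicted by the standard
relations but not yet realised by an explicit chain in this series.

Sources: Aoki–Shioda standard cycles (J. Math. Soc. Japan 39 (1987), doi:10.2969/jmsj/03930385);
the explicit one-dimensional realisation appears to be new.
-/

open MeasureTheory Set Real MvPolynomial
open Literature.NumberTheory.Transcendental
open Literature.NumberTheory.Transcendental.KZ
open Literature.NumberTheory.Transcendental.KZ.IntegralRep
open Literature.ModelTheory.ExponentialFields

noncomputable section

namespace Summit.KontsevichZagierPeriods.KontsevichZagierPeriods.Theorems

namespace SoloBlind

variable {x : ℚ}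

/-! ## On the closed interval -/

/-- `P` is `ℚ`-semialgebraic on `[0,1]` (`0 < x < 1/2`). -/
theorem sa_qjP (hx : 0 < x) (hx2 : 2 * x < 1) :
    IsSemialgebraicFunOn ℚ (line (Icc 0 1)) fun v => qjP x (v 0) := by
  refine isSemialgebraicFunOn_Icc_of_Ioo ?_ 0 0 (fun v hv => ?_) (fun v hv => ?_)
  · refine (sa_qj_shape x (-(2 * X 0 ^ 2)) (1 + X 0 ^ 2)
      fun v _ => ?_).congr fun v hv => ?_
    · have : (0:ℝ) < 1 + v 0 ^ 2 := by positivity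
      simpa using this.ne'
    · have hv' : v 0 ∈ Ioo (0:ℝ) 1 := hv
      simp [qjP_eq hv', qjL]
      ring
  · rw [hv, qjP_zero hx2, Rat.cast_zero]
  · rw [hv, qjP_one hx, Rat.cast_zero]

/-- The exact integrand is `ℚ`-semialgebraic on `[0,1]`. -/
theorem sa_qjE (x : ℚ) : IsSemialgebraicFunOn ℚ (line (Icc 0 1)) fun v => qjE x (v 0) := by
  refine isSemialgebraicFunOn_Icc_of_Ioo (sa_qjE_Ioo x) 0 0 (fun v hv => ?_) (fun v hv => ?_)
  · have h0 : v 0 ∉ Ioo (0:ℝ) 1 := fun h => by rw [hv] at h; exact lt_irrefl _ h.1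
    rw [qjE, if_neg h0, Rat.cast_zero]
  · have h0 : v 0 ∉ Ioo (0:ℝ) 1 := fun h => by rw [hv] at h; exact lt_irrefl _ h.2
    rw [qjE, if_neg h0, Rat.cast_zero]

/-- The exact integrand is integrable on `[0,1]`. -/
theorem integrableOn_qjE (hx : 0 < x) (hx2 : 2 * x < 1) : IntegrableOn (qjE x) (Icc 0 1) := by
  rw [integrableOn_Icc_iff_integrableOn_Ioo]
  exact IntegrableOn.congr_fun
    (((integrableOn_qjGC x hx hx2).const_mul
      ((((-((1 - 4 * x) / 2)) : ℚ) : ℝ) * (64:ℝ) ^ (x : ℝ))).add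
      (((integrableOn_qjGB x hx hx2).const_mul ((((1 - 6 * x) : ℚ)) : ℝ)).add
        ((integrableOn_qjGA x hx hx2).const_mul ((((1 + 2 * x) : ℚ)) : ℝ))))
    (fun v hv => by simp only [qjE, if_pos hv, Pi.add_apply]) measurableSet_Ioo

/-! ## The coefficient `κ_x = ((1-4x)/2)·64^{x}` -/

/-- `κ_x` is algebraic. -/
theorem isAlgebraic_qjC (x : ℚ) :
    IsAlgebraic ℚ (((((1 - 4 * x) / 2 : ℚ)) : ℝ) * (64:ℝ) ^ (x : ℝ)) :=
  (isAlgebraic_rat ℚ ((1 - 4 * x) / 2)).mul (qu_isAlgebraic_rpow x)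

/-- `κ_x` as an element of `K₀`. -/
def qjCK (x : ℚ) : K₀ :=
  ⟨((((1 - 4 * x) / 2 : ℚ)) : ℝ) * (64:ℝ) ^ (x : ℝ), mem_K₀_iff.mpr (isAlgebraic_qjC x)⟩

/-- `(κ_x : ℝ) = ((1-4x)/2)·64^{x}`. -/
@[simp] theorem coe_qjCK (x : ℚ) :
    ((qjCK x : K₀) : ℝ) = ((((1 - 4 * x) / 2 : ℚ)) : ℝ) * (64:ℝ) ^ (x : ℝ) := rfl

/-- `κ_x ≠ 0` for `x < 1/4`. -/
theorem qjCK_ne_zero (hx4 : 4 * x < 1) : qjCK x ≠ 0 := by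
  intro h
  have h' := congrArg (fun z : K₀ => (z : ℝ)) h
  simp only [coe_qjCK, ZeroMemClass.coe_zero] at h'
  have h1 : (0:ℝ) < ((((1 - 4 * x) / 2 : ℚ)) : ℝ) := by
    have : (0:ℚ) < (1 - 4 * x) / 2 := by linarith
    exact_mod_cast this
  have : (0:ℝ) < ((((1 - 4 * x) / 2 : ℚ)) : ℝ) * (64:ℝ) ^ (x : ℝ) := by positivity
  linarith

/-! ## The representations and the moves -/

/-- `R_A = [(0,1), G_A]`. -/
def qjRA (x : ℚ) (hx : 0 < x) (hx2 : 2 * x < 1) : IntegralRep 1 :=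
  lineRep (Ioo 0 1) (qjGA x) mix_line_sa (sa_qjGA x) (integrableOn_qjGA x hx hx2)

/-- `R_B = [(0,1), G_B]`. -/
def qjRB (x : ℚ) (hx : 0 < x) (hx2 : 2 * x < 1) : IntegralRep 1 :=
  lineRep (Ioo 0 1) (qjGB x) mix_line_sa (sa_qjGB x) (integrableOn_qjGB x hx hx2)

/-- `R_C = [(0,1), G_C]`. -/
def qjRC (x : ℚ) (hx : 0 < x) (hx2 : 2 * x < 1) : IntegralRep 1 :=
  lineRep (Ioo 0 1) (qjGC x) mix_line_sa (sa_qjGC x) (integrableOn_qjGC x hx hx2)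

/-- The combination `W = (1-6x)·G_B + (1+2x)·G_A`. -/
def qjW (x : ℚ) (m : ℝ) : ℝ :=
  ((((1 - 6 * x) : ℚ)) : ℝ) * qjGB x m + ((((1 + 2 * x) : ℚ)) : ℝ) * qjGA x m

/-- `[(0,1), W]`. -/
def qjWRep (x : ℚ) (hx : 0 < x) (hx2 : 2 * x < 1) : IntegralRep 1 :=
  lineRep (Ioo 0 1) (qjW x) mix_line_sa
    (((isSemialgebraicFunOn_const_of_isAlgebraic mix_line_sa
      (isAlgebraic_rat ℚ (1 - 6 * x))).mul_holds (sa_qjGB x)).add_holds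
      ((isSemialgebraicFunOn_const_of_isAlgebraic mix_line_sa
        (isAlgebraic_rat ℚ (1 + 2 * x))).mul_holds (sa_qjGA x)))
    (((integrableOn_qjGB x hx hx2).const_mul _).add ((integrableOn_qjGA x hx hx2).const_mul _))

/-- `X = [[0,1], P']`. -/
def qjExact (x : ℚ) (hx : 0 < x) (hx2 : 2 * x < 1) : IntegralRep 1 :=
  lineRep (Icc 0 1) (qjE x) (isSemialgebraic_line_Icc isAlgebraic_zero isAlgebraic_one)
    (sa_qjE x) (integrableOn_qjE hx hx2)

/-- **Move A (substitution `σ = φ_A(m)`):** `R_A ≡ β(4x, 3/2-3x)`. -/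
theorem qjRA_sub_betaRep (x : ℚ) (hx : 0 < x) (hx2 : 2 * x < 1) :
    of (qjRA x hx hx2) - of (betaRep (4 * x) (3 / 2 - 3 * x) (by positivity) (by linarith)) ∈
      relations := by
  unfold qjRA betaRep
  exact lineRep_subst quA quA' sa_quA (fun m _ => (hasDerivAt_quA m).hasDerivWithinAt) injOn_quA
    image_quA (fun m hm => qj_pullA x hm)

/-- **Move B (substitution `σ = φ_B(m)`):** `R_B ≡ β(½-x, 4x)`. -/
theorem qjRB_sub_betaRep (x : ℚ) (hx : 0 < x) (hx2 : 2 * x < 1) :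
    of (qjRB x hx hx2) - of (betaRep (1 / 2 - x) (4 * x) (by linarith) (by positivity)) ∈
      relations := by
  unfold qjRB betaRep
  exact lineRep_subst quB quB' sa_quB (fun m _ => (hasDerivAt_quB m).hasDerivWithinAt) injOn_quB
    image_quB (fun m hm => qj_pullB x hm)

/-- **Move C (substitution `s = ψ(m)`):** `R_C ≡ β(3/2-3x, x)`. -/
theorem qjRC_sub_betaRep (x : ℚ) (hx : 0 < x) (hx2 : 2 * x < 1) :
    of (qjRC x hx hx2) - of (betaRep (3 / 2 - 3 * x) x (by linarith) hx) ∈ relations := by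
  unfold qjRC betaRep
  exact lineRep_subst quS quS' sa_quS (fun m _ => (hasDerivAt_quS m).hasDerivWithinAt) injOn_quS
    image_quS (fun m hm => qj_pullC x hm)

/-- **Move D, rule (3) (Newton–Leibniz):** `[[0,1], P'] ∈ relations`, since `P(1) - P(0) = 0`. -/
theorem qjExact_mem (x : ℚ) (hx : 0 < x) (hx2 : 2 * x < 1) :
    of (qjExact x hx hx2) ∈ relations := by
  have h0 : qjP x 1 - qjP x 0 = 0 := by rw [qjP_one hx, qjP_zero hx2, sub_zero]
  have h1 : of (qjExact x hx hx2) -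
      of (constCell (qjP x 1 - qjP x 0) (by rw [h0]; exact isAlgebraic_zero)) ∈ relations :=
    lineRep_newtonLeibniz isAlgebraic_zero isAlgebraic_one zero_le_one (qjP x)
      (sa_qjP hx hx2) (continuous_qjP hx hx2).continuousOn
      fun t ht => hasDerivAt_qjP ht
  have hc : of (constCell (qjP x 1 - qjP x 0) (by rw [h0]; exact isAlgebraic_zero)) ∈
      relations := by
    rw [constCell_congr h0 (hβ := isAlgebraic_zero)]
    exact constCell_zero
  simpa using relations.add_mem h1 hc

/-- `X⁰ = [(0,1), P']`, the open restriction. -/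
def qjExactO (x : ℚ) (hx : 0 < x) (hx2 : 2 * x < 1) : IntegralRep 1 :=
  (qjExact x hx hx2).restrict (line (Ioo 0 1)) mix_line_sa fun _ hv => Ioo_subset_Icc_self hv

/-- `[(0,1), P'] ∈ relations`. -/
theorem qjExactO_mem (x : ℚ) (hx : 0 < x) (hx2 : 2 * x < 1) :
    of (qjExactO x hx hx2) ∈ relations := by
  have h1 : of (qjExact x hx hx2) - of (qjExactO x hx hx2) ∈ relations := by
    refine IntegralRep.of_sub_of_restrict_mem_relations _ _ _ ?_
    show volume (line (Icc (0 : ℝ) 1) \ line (Ioo 0 1)) = 0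
    rw [← show line (Icc (0 : ℝ) 1 \ Ioo 0 1) = line (Icc (0 : ℝ) 1) \ line (Ioo 0 1) from rfl,
      volume_line, Icc_sdiff_Ioo_same zero_le_one]
    exact (toFinite _).measure_zero _
  have h2 := relations.sub_mem (qjExact_mem x hx hx2) h1
  rwa [sub_sub_cancel] at h2

/-- **Move E, rule (1b):** `[(0,1), W] ≡ κ_x•R_C + [(0,1), P']`. -/
theorem qjWRep_sub_sub_exact (x : ℚ) (hx : 0 < x) (hx2 : 2 * x < 1) :
    of (qjWRep x hx hx2) - of ((qjRC x hx hx2).constMul _ (isAlgebraic_qjC x)) -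
      of (qjExactO x hx hx2) ∈ relations := by
  refine of_sub_sub_mem_relations_of_add rfl rfl fun v hv => ?_
  have hv' : v 0 ∈ Ioo (0 : ℝ) 1 := hv
  simp only [qjExactO, IntegralRep.integrand_restrict, qjExact, lineRep_integrand,
    IntegralRep.integrand_constMul, qjRC, qjWRep]
  rw [qjE, if_pos hv', qjW]
  push_cast
  ring

/-- **Move F, rule (1b):** `[(0,1), W] ≡ (1-6x)•R_B + (1+2x)•R_A`. -/
theorem qjWRep_sub_sub (x : ℚ) (hx : 0 < x) (hx2 : 2 * x < 1) :
    of (qjWRep x hx hx2) -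
      of ((qjRB x hx hx2).constMul ((((1 - 6 * x) : ℚ)) : ℝ) (isAlgebraic_rat ℚ (1 - 6 * x))) -
      of ((qjRA x hx hx2).constMul ((((1 + 2 * x) : ℚ)) : ℝ) (isAlgebraic_rat ℚ (1 + 2 * x))) ∈
      relations :=
  of_sub_sub_mem_relations_of_add rfl rfl fun _ _ => rfl

/-! ## Assembly in `Q` -/

/-- `[R_A] = β(4x, 3/2-3x)`. -/
theorem qjRA_eq (x : ℚ) (hx : 0 < x) (hx2 : 2 * x < 1) :
    mkQ (of (qjRA x hx hx2)) = betaQ (4 * x) (3 / 2 - 3 * x) := by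
  rw [betaQ_eq (by positivity) (by linarith)]
  exact mkQ_eq_mkQ_iff.mpr (qjRA_sub_betaRep x hx hx2)

/-- `[R_B] = β(½-x, 4x)`. -/
theorem qjRB_eq (x : ℚ) (hx : 0 < x) (hx2 : 2 * x < 1) :
    mkQ (of (qjRB x hx hx2)) = betaQ (1 / 2 - x) (4 * x) := by
  rw [betaQ_eq (by linarith) (by positivity)]
  exact mkQ_eq_mkQ_iff.mpr (qjRB_sub_betaRep x hx hx2)

/-- `[R_C] = β(3/2-3x, x)`. -/
theorem qjRC_eq (x : ℚ) (hx : 0 < x) (hx2 : 2 * x < 1) :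
    mkQ (of (qjRC x hx hx2)) = betaQ (3 / 2 - 3 * x) x := by
  rw [betaQ_eq (by linarith) hx]
  exact mkQ_eq_mkQ_iff.mpr (qjRC_sub_betaRep x hx hx2)

/-- `[(0,1), W] = (1-6x)•β(½-x,4x) + (1+2x)•β(4x,3/2-3x)` in `Q`. -/
theorem mkQ_qjWRep (x : ℚ) (hx : 0 < x) (hx2 : 2 * x < 1) :
    mkQ (of (qjWRep x hx hx2)) =
      (((1 - 6 * x) : ℚ) : K₀) • betaQ (1 / 2 - x) (4 * x) +
        (((1 + 2 * x) : ℚ) : K₀) • betaQ (4 * x) (3 / 2 - 3 * x) := by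
  have h1 := qjWRep_sub_sub x hx hx2
  rw [sub_sub] at h1
  have h2 := mkQ_eq_mkQ_iff.mpr h1
  rwa [map_add, mkQ_constMul_ratCast, mkQ_constMul_ratCast, qjRB_eq, qjRA_eq] at h2

/-- `[(0,1), W] = κ_x • β(3/2-3x, x)` in `Q`. -/
theorem mkQ_qjWRep_eq_C (x : ℚ) (hx : 0 < x) (hx2 : 2 * x < 1) :
    mkQ (of (qjWRep x hx hx2)) = qjCK x • betaQ (3 / 2 - 3 * x) x := by
  have h1 := relations.add_mem (qjWRep_sub_sub_exact x hx hx2) (qjExactO_mem x hx hx2)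
  rw [sub_add_cancel] at h1
  have h2 := mkQ_eq_mkQ_iff.mpr h1
  rw [mkQ_constMul, qjRC_eq] at h2
  exact h2

/-- **The fourth second-kind quartic family inside the Kontsevich–Zagier rules:**
`(1-6x) • β(½-x, 4x) + (1+2x) • β(4x, 3/2-3x) = ((1-4x)/2)·64^{x} • β(3/2-3x, x)` for rational
`0 < x < 1/2` — three substitutions, ONE Newton–Leibniz move, two additivity splits. -/
theorem betaQ_quarticS1 (x : ℚ) (hx : 0 < x) (hx2 : 2 * x < 1) :
    (((1 - 6 * x) : ℚ) : K₀) • betaQ (1 / 2 - x) (4 * x) +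
        (((1 + 2 * x) : ℚ) : K₀) • betaQ (4 * x) (3 / 2 - 3 * x) =
      qjCK x • betaQ (3 / 2 - 3 * x) x := by
  rw [← mkQ_qjWRep x hx hx2, mkQ_qjWRep_eq_C x hx hx2]

/-- Period check: `(1-6x)B(½-x,4x) + (1+2x)B(4x,3/2-3x) = ((1-4x)/2)64^{x}B(3/2-3x,x)`. -/
theorem beta_quarticS1_value (x : ℚ) (hx : 0 < x) (hx2 : 2 * x < 1) :
    (1 - 6 * (x : ℝ)) * evalQ (betaQ (1 / 2 - x) (4 * x)) +
        (1 + 2 * (x : ℝ)) * evalQ (betaQ (4 * x) (3 / 2 - 3 * x)) =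
      (1 - 4 * (x : ℝ)) / 2 * (64:ℝ) ^ (x : ℝ) * evalQ (betaQ (3 / 2 - 3 * x) x) := by
  have h := congrArg evalQ (betaQ_quarticS1 x hx hx2)
  rw [map_add, evalQ_smul, evalQ_smul, evalQ_smul, coe_qjCK] at h
  push_cast at h
  exact h

/-! ## The orbit merge -/

/-- **Fourth second-kind quartic merge: `β(½-x, 4x) ≐ β(3/2-3x, x)`** for rational
`1/6 < x < 1/4`: the orbit of `{½-x, 4x, 3/2-3x}` meets that of `{3/2-3x, x, ½+2x}`.  Precisely
`((1-6x)(1+2x)/2)(sin π(3/2-3x) - sin π(½-x)) • β(½-x, 4x) = ((½+x) sin π(3/2-3x) κ_x) • β(3/2-3x, x)`.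
-/
theorem betaQ_propTo_quarticS1 (x : ℚ) (hx6 : 1 < 6 * x) (hx4 : 4 * x < 1) :
    PropTo (betaQ (1 / 2 - x) (4 * x)) (betaQ (3 / 2 - 3 * x) x) := by
  have hx : 0 < x := by linarith
  have hx2 : 2 * x < 1 := by linarith
  have key := betaQ_quarticS1 x hx hx2
  -- second-kind orbit relation inside `{4x, 3/2-3x, ½-x}`
  have hp := betaQ_second_rat (3 / 2 - 3 * x) (1 / 2 - x) (by linarith) (by linarith)
    (by linarith)
  rw [show (2:ℚ) - (3 / 2 - 3 * x) - (1 / 2 - x) = 4 * x by ring,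
    betaQ_symm (show (0:ℚ) < 3 / 2 - 3 * x by linarith) (show (0:ℚ) < 4 * x by positivity)]
    at hp
  -- hp : (1-(½-x)) • sinQ(3/2-3x) • β(4x, 3/2-3x) = (1-(3/2-3x)) • sinQ(½-x) • β(½-x, 4x)
  have hsc : sinQ (3 / 2 - 3 * x) = sinQ (3 * x - 1 / 2) := by
    rw [show (3 / 2 - 3 * x : ℚ) = 1 - (3 * x - 1 / 2) by ring, sinQ_one_sub]
  have hs := sinQ_sub_sinQ_ne_zero_of_lt (p := 3 * x - 1 / 2) (q := 1 / 2 - x) (by linarith)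
    (by linarith) (by linarith)
  refine PropTo.of_smul_eq_smul
    (c := (((1 - 6 * x) * (1 + 2 * x) / 2 : ℚ) : K₀) * (sinQ (3 / 2 - 3 * x) - sinQ (1 / 2 - x)))
    (c' := ((1 - (1 / 2 - x) : ℚ) : K₀) * sinQ (3 / 2 - 3 * x) * qjCK x)
    (mul_ne_zero (by exact_mod_cast (show ((1 - 6 * x) * (1 + 2 * x) / 2 : ℚ) ≠ 0 by
        have h1 : (1 - 6 * x : ℚ) ≠ 0 := by linarith
        have h2 : (1 + 2 * x : ℚ) ≠ 0 := by linarith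
        positivity))
      (by rw [hsc]; exact fun h => hs (by linear_combination -h)))
    (mul_ne_zero (mul_ne_zero (by exact_mod_cast (show (1 - (1 / 2 - x) : ℚ) ≠ 0 by linarith))
      (sinQ_ne_zero (by linarith) (by linarith))) (qjCK_ne_zero hx4)) ?_
  have key' := congrArg (fun z => (((1 - (1 / 2 - x) : ℚ) : K₀) * sinQ (3 / 2 - 3 * x)) • z) key
  simp only [smul_add, ← smul_assoc, smul_eq_mul] at key'
  have hp' := congrArg (fun z => (((1 + 2 * x) : ℚ) : K₀) • z) hp
  simp only [← smul_assoc, smul_eq_mul] at hp'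
  have e1 : ((1 - (1 / 2 - x) : ℚ) : K₀) * sinQ (3 / 2 - 3 * x) * (((1 + 2 * x) : ℚ) : K₀) =
      (((1 + 2 * x) : ℚ) : K₀) * (((1 - (1 / 2 - x) : ℚ) : K₀) * sinQ (3 / 2 - 3 * x)) := by
    ring
  rw [e1, hp'] at key'
  have e2 : (((1 - 6 * x) * (1 + 2 * x) / 2 : ℚ) : K₀) * (sinQ (3 / 2 - 3 * x) - sinQ (1 / 2 - x)) =
      ((1 - (1 / 2 - x) : ℚ) : K₀) * sinQ (3 / 2 - 3 * x) * (((1 - 6 * x) : ℚ) : K₀) +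
        (((1 + 2 * x) : ℚ) : K₀) * (((1 - (3 / 2 - 3 * x) : ℚ) : K₀) * sinQ (1 / 2 - x)) := by
    push_cast
    ring
  rw [e2, add_smul]
  exact key'

/-! ## Instances -/

/-- Level `14` (`x = 3/14`): `β(2/7, 6/7) ≐ β(6/7, 3/14)` — `{4,12,12}` meets `{3,12,13}`. -/
theorem betaQ_propTo_fourteen_qj :
    PropTo (betaQ (2 / 7) (6 / 7)) (betaQ (6 / 7) (3 / 14)) := by
  have h := betaQ_propTo_quarticS1 (3 / 14) (by norm_num) (by norm_num)
  norm_num at h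
  exact h

/-- Level `16` (`x = 3/16`): `β(5/16, 3/4) ≐ β(15/16, 3/16)` — `{5,12,15}` meets `{3,14,15}`. -/
theorem betaQ_propTo_sixteen_qj :
    PropTo (betaQ (5 / 16) (3 / 4)) (betaQ (15 / 16) (3 / 16)) := by
  have h := betaQ_propTo_quarticS1 (3 / 16) (by norm_num) (by norm_num)
  norm_num at h
  exact h

/-- Level `10` (`x = 1/5`): `β(3/10, 4/5) ≐ β(9/10, 1/5)` — `{3,8,9}` meets `{2,9,9}`. -/
theorem betaQ_propTo_ten_qj : PropTo (betaQ (3 / 10) (4 / 5)) (betaQ (9 / 10) (1 / 5)) := by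
  have h := betaQ_propTo_quarticS1 (1 / 5) (by norm_num) (by norm_num)
  norm_num at h
  exact h

/-- Level `24` (`x = 5/24`): `β(7/24, 5/6) ≐ β(7/8, 5/24)` — `{7,20,21}` meets `{5,21,22}`. -/
theorem betaQ_propTo_twentyfour_qj :
    PropTo (betaQ (7 / 24) (5 / 6)) (betaQ (7 / 8) (5 / 24)) := by
  have h := betaQ_propTo_quarticS1 (5 / 24) (by norm_num) (by norm_num)
  norm_num at h
  exact h

end SoloBlind

end Summit.KontsevichZagierPeriods.KontsevichZagierPeriods.Theorems
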